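import Mathlib.Analysis.CStarAlgebra.CStarMatrix
import Mathlib.Analysis.CStarAlgebra.ContinuousMap
import Mathlib.Algebra.Star.UnitaryStarAlgAut
import Mathlib.Topology.UnitInterval
import Mathlib.Topology.Instances.Matrix
import Mathlib.Analysis.SpecialFunctions.Trigonometric.Basic
import Mathlib.Analysis.SpecialFunctions.Exp
import Mathlib.LinearAlgebra.Basis.VectorSpace
import Mathlib.Algebra.Polynomial.Roots
import Mathlib.Order.Interval.Set.Infinite
import Literature.Analysis.FunctionSpaces.KMSStatesProofs
import HarnessLib

/-!
# The named fact `Literature.MathematicalPhysics.QuantumLattice.State.isKMSState_iff_entire` is false as stated (a counterexample)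

`Literature/Analysis/FunctionSpaces/KMSStates.lean` states the equivalence "KMS condition in the
strip form ⇔ KMS condition on entire elements" (Bratteli–Robinson II Def. 5.3.1 ⇔ Prop. 5.3.7) as
the named fact `Literature.MathematicalPhysics.QuantumLattice.State.isKMSState_iff_entire` in a section carrying only `[PartialOrder A]`,
i.e. for an *arbitrary* partial order on the C⋆-algebra `A`.  A `State A` is a linear functional
that is monotone for that order and normalised; for the *discrete* order every linear functional
`ω` with `ω 1 = 1` qualifies, continuous or not, whereas the printed proof (and the truth of the
statement) needs the continuity of `ω`, which for states of a C⋆-algebra comes from positivity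
for the C⋆-order (Bratteli–Robinson I Prop. 2.3.11).  This file proves that the fact is indeed
false in that generality (`Literature.Analysis.FunctionSpaces.KMSEntireCounterexample.not_isKMSState_iff_entire`,
`Literature.MathematicalPhysics.QuantumLattice.State.not_isKMSState_iff_entire`): its universal closure over all `[PartialOrder A]` fails.
For states of the C⋆-algebra, i.e. under the additional instance hypothesis `[StarOrderedRing A]`
(the order is the C⋆-order, so that states are continuous), the equivalence does hold, with the
printed proof: it is the corrected named fact `Literature.MathematicalPhysics.QuantumLattice.State.isKMSState_iff_entire'`
(`KMSStates.lean`), discharged as `Literature.MathematicalPhysics.QuantumLattice.State.isKMSState_iff_entire'_holds` from the explicit form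
`Literature.MathematicalPhysics.QuantumLattice.State.isKMSState_iff_forall_entire` in the sibling file `KMSStatesProofs.lean`; the present
file shows that this hypothesis cannot be dropped.  (It is unrelated to the other counterexample
file of this directory, `KMSStatesCounterexample.lean`, which concerns ground states.)

## The counterexample

* `K = M₂(C([0,1], ℂ))` (Mathlib's `CStarMatrix (Fin 2) (Fin 2) C(unitInterval, ℂ)`), as a type
  synonym `Literature.Analysis.FunctionSpaces.KMSEntireCounterexample.K` carrying the C⋆-algebra structure of `CStarMatrix` and the
  discrete partial order.
* Dynamics `τ_t = Ad U_t`, `U_t = diag(1, e_t)`, `e_t(x) = e^{itx}` (`Unitary.conjStarAlgAut`);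
  this is a strongly continuous one-parameter group of ⋆-automorphisms
  (`Literature.Analysis.FunctionSpaces.KMSEntireCounterexample.isAutomorphismGroup_τ`), and entrywise
  `τ_t(a)_{jk}(x) = e^{it(η_j - η_k)x} a_{jk}(x)` with `η = (0, 1)`.
* Uniqueness of analytic continuation (`Literature.Analysis.FunctionSpaces.entire_eq_of_eqOn_real` of `KMSStatesProofs.lean`),
  applied to the scalar functions `z ↦ F(z)_{jk}(x)`, gives
  `F(z)_{jk}(x) = e^{iz(η_j - η_k)x} b_{jk}(x)` for every entire extension `F` of `t ↦ τ_t(b)`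
  (`Literature.Analysis.FunctionSpaces.KMSEntireCounterexample.apply_of_isEntireElementFor`).
* For a linear functional `φ` on `C([0,1], ℂ)` put `ω(y) = φ(y₁₁ + e^{-βx} y₂₂)`
  (`Literature.Analysis.FunctionSpaces.KMSEntireCounterexample.omega`).  A direct computation shows that `ω` satisfies the
  entire-element relation `ω(a F(iβ)) = ω(b a)` for *every* `φ`
  (`Literature.Analysis.FunctionSpaces.KMSEntireCounterexample.omega_apply_mul_entire`): `ω = ψ(e^{-βh} ·)` with
  `ψ(y) = φ(y₁₁ + y₂₂)` tracial.
* The functions `v_k(x) = (1 + e^{-βx}) e^{-ikx}`, `k ∈ ℕ`, are linearly independent in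
  `C([0,1], ℂ)` (a vanishing combination is a polynomial in `e^{-ix}` with infinitely many roots;
  `Literature.Analysis.FunctionSpaces.KMSEntireCounterexample.linearIndependent_v`), so there is a (discontinuous, Hamel-basis)
  linear functional `φ` with `φ(v_k) = k + 1` (`Literature.Analysis.FunctionSpaces.KMSEntireCounterexample.exists_functional`);
  then `ω 1 = φ(v_0) = 1`, so `ω` is a `State K` for the discrete order.
* For `a = (1 + e^{-βx}) E₂₁`, `b = E₁₂` one finds `ω(τ_k(b) a) = φ(v_k) = k + 1`, unbounded in
  `k ∈ ℕ`, whereas the strip form of the KMS condition provides a *bounded* function on the strip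
  with boundary values `F(k + iβ) = ω(τ_k(b) a)`.  Hence `ω` is not a `(τ, β)`-KMS state in the
  strip form (`Literature.Analysis.FunctionSpaces.KMSEntireCounterexample.not_isKMSState_omega`), for every `β > 0`,
  contradicting
  `State.isKMSState_iff_entire`.

## Sources

The ingredients are standard: inner one-parameter automorphism groups `Ad e^{ith}` of a
C⋆-algebra and their entire elements (O. Bratteli, D. W. Robinson, *Operator Algebras and Quantum
Statistical Mechanics I*, 2nd ed., Springer 1987, §2.5.3, Def. 2.5.20; II, 2nd ed., Springer 1997,
Def. 5.3.1, Prop. 5.3.7, Example 5.3.31 (Gibbs states of `Ad e^{itH}`)), automatic continuity of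
positive functionals (BR I Prop. 2.3.11), and the existence of discontinuous linear functionals on
an infinite-dimensional normed space via a Hamel basis (Mathlib `LinearMap.exists_extend`).  The
counterexample itself is elementary and recorded here to document the correction of the vendored
statement; all declarations are tagged `[folklore]`.
-/

noncomputable section

open scoped ComplexOrder
open Complex Filter Topology

namespace Literature.Analysis.FunctionSpaces

namespace KMSEntireCounterexample

/-! ### The algebra `K = M₂(C([0,1], ℂ))` with the discrete order -/

/-- The commutative C⋆-algebra `C([0,1], ℂ)` of the matrix entries. [folklore] -/
abbrev B : Type := C(unitInterval, ℂ)

/-- The C⋆-algebra `K = M₂(C([0,1], ℂ))`: a type synonym of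
`CStarMatrix (Fin 2) (Fin 2) C(unitInterval, ℂ)`, given below the C⋆-algebra structure of
`CStarMatrix` and the *discrete* partial order (allowed by the arbitrary `[PartialOrder A]` of
`State.isKMSState_iff_entire`). [folklore] -/
def K : Type := CStarMatrix (Fin 2) (Fin 2) B

/-- `K` is a (unital) C⋆-algebra: the `CStarMatrix` structure. [folklore] -/
instance instCStarAlgebra : CStarAlgebra K :=
  inferInstanceAs (CStarAlgebra (CStarMatrix (Fin 2) (Fin 2) B))

/-- The discrete partial order on `K` (`a ≤ b ↔ a = b`); every linear functional is monotone for
it. [folklore] -/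
instance instPartialOrder : PartialOrder K where
  le := Eq
  le_refl _ := rfl
  le_trans _ _ _ := Eq.trans
  le_antisymm _ _ h _ := h

/-- The matrix of entries of an element of `K` (the identity map to `Matrix (Fin 2) (Fin 2) B`).
[folklore] -/
def toMat : K → Matrix (Fin 2) (Fin 2) B := id

/-- The element of `K` with a given matrix of entries (the identity map). [folklore] -/
def ofMat : Matrix (Fin 2) (Fin 2) B → K := id

/-- `toMat ∘ ofMat = id`. [folklore] -/
@[simp] theorem toMat_ofMat (M : Matrix (Fin 2) (Fin 2) B) : toMat (ofMat M) = M := rfl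

/-- `toMat` is injective. [folklore] -/
theorem toMat_injective : Function.Injective toMat := fun _ _ h => h

/-- `toMat` is multiplicative (matrix multiplication). [folklore] -/
@[simp] theorem toMat_mul (a b : K) : toMat (a * b) = toMat a * toMat b := rfl

/-- `toMat` is additive. [folklore] -/
@[simp] theorem toMat_add (a b : K) : toMat (a + b) = toMat a + toMat b := rfl

/-- `toMat 1 = 1`. [folklore] -/
@[simp] theorem toMat_one : toMat (1 : K) = 1 := rfl

/-- `toMat` intertwines the star with the conjugate transpose. [folklore] -/
@[simp] theorem toMat_star (a : K) : toMat (star a) = (toMat a).conjTranspose := rfl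

/-- `toMat` is `ℂ`-homogeneous. [folklore] -/
@[simp] theorem toMat_smul (c : ℂ) (a : K) : toMat (c • a) = c • toMat a := rfl

/-- Entries are bounded by the C⋆-norm (`CStarMatrix.norm_entry_le_norm`). [folklore] -/
theorem norm_toMat_apply_le (a : K) (i j : Fin 2) : ‖toMat a i j‖ ≤ ‖a‖ :=
  CStarMatrix.norm_entry_le_norm (M := (a : CStarMatrix (Fin 2) (Fin 2) B))

/-- `ofMat` is continuous (the C⋆-norm topology of `CStarMatrix` is the product topology,
`CStarMatrix.ofMatrixL`). [folklore] -/
theorem continuous_ofMat : Continuous ofMat :=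
  (CStarMatrix.ofMatrixL (m := Fin 2) (n := Fin 2) (A := B)).continuous

/-- The `(j, k)` entry as a continuous linear map `K →L[ℂ] C([0,1], ℂ)`. [folklore] -/
def entryCLM (j k : Fin 2) : K →L[ℂ] B :=
  LinearMap.mkContinuous ⟨⟨fun a => toMat a j k, fun _ _ => rfl⟩, fun _ _ => rfl⟩ 1 fun a => by
    simpa using norm_toMat_apply_le a j k

/-- `entryCLM j k a = (toMat a) j k`. [folklore] -/
@[simp] theorem entryCLM_apply (j k : Fin 2) (a : K) : entryCLM j k a = toMat a j k := rfl

/-! ### The dynamics `τ_t = Ad diag(1, e^{itx})` -/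

/-- The function `x ↦ exp (c x)` on `[0,1]` as an element of `C([0,1], ℂ)`. [folklore] -/
def expB (c : ℂ) : B := ⟨fun x => exp (c * (x : ℝ)), by fun_prop⟩

/-- Pointwise values of `expB`. [folklore] -/
@[simp] theorem expB_apply (c : ℂ) (x : unitInterval) : expB c x = exp (c * (x : ℝ)) := rfl

/-- `c ↦ expB c` is continuous into `C([0,1], ℂ)` (joint continuity and currying on the compact
interval). [folklore] -/
theorem continuous_expB : Continuous expB := by
  refine ContinuousMap.continuous_of_continuous_uncurry _ ?_
  change Continuous fun p : ℂ × unitInterval => exp (p.1 * ((p.2 : ℝ) : ℂ))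
  fun_prop

/-- The frequencies `η = (0, 1)` of the diagonal Hamiltonian `h = diag(0, x)`. [folklore] -/
def η : Fin 2 → ℝ := ![0, 1]

/-- `η 0 = 0`. [folklore] -/
@[simp] theorem η_zero : η 0 = 0 := rfl

/-- `η 1 = 1`. [folklore] -/
@[simp] theorem η_one : η 1 = 1 := rfl

/-- The diagonal entries `u_t j = e^{itη_j x}` of the implementing unitaries. [folklore] -/
def u (t : ℝ) (j : Fin 2) : B := expB (I * t * η j)

/-- Pointwise values of `u`. [folklore] -/
theorem u_apply (t : ℝ) (j : Fin 2) (x : unitInterval) :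
    u t j x = exp (I * t * η j * (x : ℝ)) := rfl

/-- `ū_t j · u_t j = 1` pointwise. [folklore] -/
theorem conj_u_mul_u (t : ℝ) (j : Fin 2) (x : unitInterval) :
    (starRingEnd ℂ) (u t j x) * u t j x = 1 := by
  rw [u_apply, ← exp_conj, ← exp_add]
  simp only [map_mul, conj_I, conj_ofReal]
  convert exp_zero using 2
  ring

/-- `star (u_t j) * u_t j = 1` in `C([0,1], ℂ)`. [folklore] -/
theorem star_u_mul_u (t : ℝ) (j : Fin 2) : star (u t j) * u t j = 1 := by
  ext x
  simpa using conj_u_mul_u t j x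

/-- `u_{s+t} = u_s u_t`. [folklore] -/
theorem u_add (s t : ℝ) (j : Fin 2) : u (s + t) j = u s j * u t j := by
  ext x
  simp only [u_apply, ContinuousMap.mul_apply, ← exp_add, ofReal_add]
  congr 1
  ring

/-- `u_0 = 1`. [folklore] -/
theorem u_zero : u 0 = fun _ => 1 := by
  funext j
  ext x
  simp [u_apply]

/-- `t ↦ u_t` is continuous. [folklore] -/
theorem continuous_u : Continuous u :=
  continuous_pi fun j => continuous_expB.comp (by fun_prop)

/-- The implementing unitaries `U_t = diag(u_t) = diag(1, e^{itx})` of `K`. [folklore] -/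
def U (t : ℝ) : unitary K :=
  ⟨ofMat (Matrix.diagonal (u t)), by
    rw [Unitary.mem_iff]
    constructor
    · apply toMat_injective
      rw [toMat_mul, toMat_star, toMat_ofMat, Matrix.diagonal_conjTranspose,
        Matrix.diagonal_mul_diagonal, toMat_one, ← Matrix.diagonal_one]
      congr 1
      funext j
      exact star_u_mul_u t j
    · apply toMat_injective
      rw [toMat_mul, toMat_star, toMat_ofMat, Matrix.diagonal_conjTranspose,
        Matrix.diagonal_mul_diagonal, toMat_one, ← Matrix.diagonal_one]
      congr 1
      funext j
      rw [mul_comm]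
      exact star_u_mul_u t j⟩

/-- Entries of `U_t`. [folklore] -/
@[simp] theorem toMat_U (t : ℝ) : toMat (U t : K) = Matrix.diagonal (u t) := rfl

/-- `U_{s+t} = U_s U_t`. [folklore] -/
theorem U_add (s t : ℝ) : U (s + t) = U s * U t := by
  apply Subtype.ext
  apply toMat_injective
  change Matrix.diagonal (u (s + t)) = Matrix.diagonal (u s) * Matrix.diagonal (u t)
  rw [Matrix.diagonal_mul_diagonal]
  congr 1
  funext j
  exact u_add s t j

/-- `U_0 = 1`. [folklore] -/
theorem U_zero : U 0 = 1 := by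
  apply Subtype.ext
  apply toMat_injective
  change Matrix.diagonal (u 0) = 1
  rw [u_zero, Matrix.diagonal_one]

/-- `t ↦ U_t` is norm continuous. [folklore] -/
theorem continuous_U : Continuous fun t : ℝ => (U t : K) := by
  change Continuous fun t : ℝ => ofMat (Matrix.diagonal (u t))
  exact continuous_ofMat.comp (Continuous.matrix_diagonal continuous_u)

/-- The dynamics `τ_t = Ad U_t` on `K` (`Unitary.conjStarAlgAut`). [folklore] -/
def τ : ℝ → (K ≃⋆ₐ[ℂ] K) := fun t => Unitary.conjStarAlgAut ℂ K (U t)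

/-- `τ_t(a) = U_t a U_t⋆`. [folklore] -/
theorem τ_apply (t : ℝ) (a : K) : τ t a = U t * a * star (U t : K) := rfl

/-- Entries of `τ_t(a)`: `τ_t(a)_{jk} = u_t j · a_{jk} · (u_t k)⋆`. [folklore] -/
theorem toMat_τ_apply (t : ℝ) (a : K) (j k : Fin 2) :
    toMat (τ t a) j k = u t j * toMat a j k * star (u t k) := by
  rw [τ_apply, toMat_mul, toMat_mul, toMat_star, toMat_U, Matrix.diagonal_conjTranspose,
    Matrix.mul_diagonal, Matrix.diagonal_mul]
  rfl

/-- Pointwise entries of `τ_t(a)`: `τ_t(a)_{jk}(x) = e^{it(η_j - η_k)x} a_{jk}(x)`. [folklore] -/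
theorem τ_apply_apply (t : ℝ) (a : K) (j k : Fin 2) (x : unitInterval) :
    toMat (τ t a) j k x = exp (I * t * (η j - η k) * (x : ℝ)) * toMat a j k x := by
  rw [toMat_τ_apply, ContinuousMap.mul_apply, ContinuousMap.mul_apply, ContinuousMap.star_apply,
    u_apply, u_apply, Complex.star_def, ← exp_conj]
  simp only [map_mul, conj_I, conj_ofReal]
  rw [mul_right_comm, ← exp_add]
  congr 2
  ring

/-- `τ` is a strongly continuous one-parameter group of ⋆-automorphisms of `K`. [folklore] -/
theorem isAutomorphismGroup_τ : Literature.MathematicalPhysics.QuantumLattice.IsAutomorphismGroup τ := by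
  refine ⟨?_, fun s t => ?_, fun a => ?_⟩
  · simp only [τ, U_zero, map_one]
    rfl
  · simp only [τ, U_add, Unitary.conjStarAlgAut_trans_conjStarAlgAut]
  · simp only [τ_apply]
    exact (continuous_U.mul continuous_const).mul continuous_U.star

/-! ### Entire extensions are determined entrywise -/

/-- **Entire extensions for `τ` are explicit**: if `F` is an entire extension of `t ↦ τ_t(b)`
(`IsEntireElementFor τ b F`), then `F(z)_{jk}(x) = e^{iz(η_j - η_k)x} b_{jk}(x)` for all `z`
(identity theorem `Literature.Analysis.FunctionSpaces.entire_eq_of_eqOn_real` applied to the scalar entire functions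
`z ↦ F(z)_{jk}(x)`). [folklore] -/
theorem apply_of_isEntireElementFor {b : K} {F : ℂ → K} (hF : IsEntireElementFor τ b F) (z : ℂ)
    (j k : Fin 2) (x : unitInterval) :
    toMat (F z) j k x = exp (I * z * (η j - η k) * (x : ℝ)) * toMat b j k x := by
  set f : ℂ → ℂ := fun z => toMat (F z) j k x with hf_def
  set g : ℂ → ℂ := fun z => exp (I * z * (η j - η k) * (x : ℝ)) * toMat b j k x with hg_def
  have hf : Differentiable ℂ f :=
    ((ContinuousMap.evalCLM ℂ x).comp (entryCLM j k)).differentiable.comp hF.1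
  have hg : Differentiable ℂ g := by
    simp only [hg_def]
    fun_prop
  have hfg := Literature.Analysis.FunctionSpaces.entire_eq_of_eqOn_real hf hg fun t => by
    simp only [hf_def, hg_def, hF.2 t, τ_apply_apply]
  exact congr_fun hfg z

/-! ### The functionals `ω_φ` -/

variable (β : ℝ)

/-- The weights `ρ_j = e^{-βη_j x}` (`ρ = (1, e^{-βx})`, the diagonal of `e^{-βh}`). [folklore] -/
def ρ (j : Fin 2) : B := expB (-(β : ℂ) * η j)

/-- Pointwise values of `ρ`. [folklore] -/
theorem ρ_apply (j : Fin 2) (x : unitInterval) : ρ β j x = exp (-(β : ℂ) * η j * (x : ℝ)) := rfl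

/-- The linear map `L(y) = ∑_j ρ_j y_{jj} = y₁₁ + e^{-βx} y₂₂` from `K` to `C([0,1], ℂ)`.
[folklore] -/
def L : K →ₗ[ℂ] B where
  toFun y := ∑ j, ρ β j * toMat y j j
  map_add' a b := by
    simp only [toMat_add, Matrix.add_apply, mul_add, Finset.sum_add_distrib]
  map_smul' c a := by
    simp only [toMat_smul, Matrix.smul_apply, mul_smul_comm, RingHom.id_apply, Finset.smul_sum]

/-- Pointwise values of `L`. [folklore] -/
theorem L_apply_apply (y : K) (x : unitInterval) :
    L β y x = ∑ j, ρ β j x * toMat y j j x := by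
  simp [L]

/-- The test functions `v_k(x) = (1 + e^{-βx}) e^{-ikx}`, `k ∈ ℕ`. [folklore] -/
def v (k : ℕ) : B := (1 + expB (-(β : ℂ))) * expB (-I * k)

/-- Pointwise values of `v_k`. [folklore] -/
theorem v_apply (k : ℕ) (x : unitInterval) :
    v β k x = (1 + exp (-(β : ℂ) * (x : ℝ))) * exp (-I * k * (x : ℝ)) := by
  simp [v]

/-- Pointwise values of `v_k`, power form. [folklore] -/
theorem v_apply' (k : ℕ) (x : unitInterval) :
    v β k x = (1 + exp (-(β : ℂ) * (x : ℝ))) * exp (-I * (x : ℝ)) ^ k := by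
  rw [v_apply, ← exp_nat_mul]
  congr 2
  ring

/-- `L(1) = v_0 = 1 + e^{-βx}`. [folklore] -/
theorem L_one : L β 1 = v β 0 := by
  ext x
  rw [L_apply_apply, v_apply, Fin.sum_univ_two, ρ_apply, ρ_apply, toMat_one]
  simp

/-- The functional `ω_φ(y) = φ(L y) = φ(y₁₁ + e^{-βx} y₂₂)` on `K`, a `State K` for the discrete
order as soon as `φ(1 + e^{-βx}) = 1` (`φ` an arbitrary, possibly discontinuous, linear functional
on `C([0,1], ℂ)`). [folklore] -/
def omega (φ : B →ₗ[ℂ] ℂ) (hφ : φ (v β 0) = 1) : Literature.MathematicalPhysics.QuantumLattice.State K where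
  toPositiveLinearMap :=
    { toLinearMap := φ ∘ₗ L β
      monotone' := fun a b h => le_of_eq (congrArg _ h) }
  map_one' := by
    change φ (L β 1) = 1
    rw [L_one, hφ]

/-- Values of `ω_φ`. [folklore] -/
@[simp] theorem omega_apply (φ : B →ₗ[ℂ] ℂ) (hφ : φ (v β 0) = 1) (y : K) :
    omega β φ hφ y = φ (L β y) := rfl

/-- **`ω_φ` satisfies the KMS relation on entire elements** for every linear `φ`:
`ω_φ(a F(iβ)) = ω_φ(b a)` whenever `F` is an entire extension of `t ↦ τ_t(b)`; indeed
`L(a F(iβ)) = L(b a)` in `C([0,1], ℂ)`, since `ρ_j F(iβ)_{kj} = ρ_k b_{kj}` pointwise. [folklore] -/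
theorem L_mul_entire (a b : K) (F : ℂ → K) (hF : IsEntireElementFor τ b F) :
    L β (a * F (β * I)) = L β (b * a) := by
  ext x
  have key : ∀ j k : Fin 2, ρ β j x * toMat (F (β * I)) k j x = ρ β k x * toMat b k j x := by
    intro j k
    rw [apply_of_isEntireElementFor hF, ρ_apply, ρ_apply, ← mul_assoc, ← exp_add]
    congr 2
    linear_combination ((β : ℂ) * ((η k : ℂ) - η j) * ((x : ℝ) : ℂ)) * I_sq
  rw [L_apply_apply, L_apply_apply]
  calc ∑ j, ρ β j x * toMat (a * F (β * I)) j j x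
      = ∑ j, ∑ k, toMat a j k x * (ρ β k x * toMat b k j x) := by
        refine Finset.sum_congr rfl fun j _ => ?_
        rw [toMat_mul, Matrix.mul_apply, ContinuousMap.sum_apply, Finset.mul_sum]
        refine Finset.sum_congr rfl fun k _ => ?_
        rw [ContinuousMap.mul_apply, ← key j k]
        ring
    _ = ∑ k, ρ β k x * toMat (b * a) k k x := by
        rw [Finset.sum_comm]
        refine Finset.sum_congr rfl fun k _ => ?_
        rw [toMat_mul, Matrix.mul_apply, ContinuousMap.sum_apply, Finset.mul_sum]
        refine Finset.sum_congr rfl fun j _ => ?_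
        rw [ContinuousMap.mul_apply]
        ring

/-- **`ω_φ` satisfies the KMS relation on entire elements** (`ω_φ(a F(iβ)) = ω_φ(b a)` for every
`a`, every `b` and every entire extension `F` of `t ↦ τ_t(b)`), for every linear `φ`. [folklore] -/
theorem omega_apply_mul_entire (φ : B →ₗ[ℂ] ℂ) (hφ : φ (v β 0) = 1) (a b : K) (F : ℂ → K)
    (hF : IsEntireElementFor τ b F) : omega β φ hφ (a * F (β * I)) = omega β φ hφ (b * a) := by
  rw [omega_apply, omega_apply, L_mul_entire β a b F hF]

/-! ### A discontinuous `φ` -/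

/-- `1 + e^{-βx} ≠ 0`. [folklore] -/
theorem one_add_exp_ne_zero (x : ℝ) : (1 : ℂ) + exp (-(β : ℂ) * x) ≠ 0 := by
  have h : (1 : ℂ) + exp (-(β : ℂ) * x) = ((1 + Real.exp (-(β * x)) : ℝ) : ℂ) := by
    push_cast
    ring_nf
  rw [h, Ne, ofReal_eq_zero]
  positivity

/-- `x ↦ e^{-ix}` is injective on `[0,1]` (its real part `cos x` is injective on `[0, π]`).
[folklore] -/
theorem injective_exp_neg_I_mul :
    Function.Injective fun x : unitInterval => exp (-I * (x : ℝ)) := by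
  intro x y h
  have hre := congrArg Complex.re h
  have hx : exp (-I * (x : ℝ)) = exp ((-(x : ℝ) : ℝ) * I) := by push_cast; ring_nf
  have hy : exp (-I * (y : ℝ)) = exp ((-(y : ℝ) : ℝ) * I) := by push_cast; ring_nf
  simp only [hx, hy, exp_ofReal_mul_I_re, Real.cos_neg] at hre
  have hπ : (1 : ℝ) ≤ Real.pi := by linarith [Real.pi_gt_three]
  exact Subtype.ext (Real.injOn_cos ⟨x.2.1, x.2.2.trans hπ⟩ ⟨y.2.1, y.2.2.trans hπ⟩ hre)

/-- **The functions `v_k = (1 + e^{-βx}) e^{-ikx}`, `k ∈ ℕ`, are linearly independent** in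
`C([0,1], ℂ)`: a vanishing linear combination gives, after cancelling the nonvanishing factor
`1 + e^{-βx}`, a polynomial vanishing at the infinitely many points `e^{-ix}`, `x ∈ [0,1]`.
[folklore] -/
theorem linearIndependent_v : LinearIndependent ℂ (v β) := by
  rw [linearIndependent_iff']
  intro s g hsum i hi
  set P : Polynomial ℂ := ∑ k ∈ s, Polynomial.C (g k) * Polynomial.X ^ k with hP_def
  have hroot : ∀ x : unitInterval, P.IsRoot (exp (-I * (x : ℝ))) := by
    intro x
    have hx := congrArg (fun f : B => f x) hsum
    simp only [ContinuousMap.sum_apply, ContinuousMap.smul_apply, v_apply', smul_eq_mul,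
      ContinuousMap.zero_apply] at hx
    have h1 : (1 + exp (-(β : ℂ) * (x : ℝ))) * ∑ k ∈ s, g k * exp (-I * (x : ℝ)) ^ k = 0 := by
      rw [Finset.mul_sum, ← hx]
      refine Finset.sum_congr rfl fun k _ => ?_
      ring
    have h2 := (mul_eq_zero.mp h1).resolve_left (one_add_exp_ne_zero β x)
    simp only [hP_def, Polynomial.IsRoot, Polynomial.eval_finsetSum, Polynomial.eval_mul,
      Polynomial.eval_C, Polynomial.eval_pow, Polynomial.eval_X]
    exact h2
  have hP : P = 0 := by
    apply Polynomial.eq_zero_of_infinite_isRoot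
    have : Infinite unitInterval := Set.Icc.infinite zero_lt_one
    exact (Set.infinite_range_of_injective injective_exp_neg_I_mul).mono
      (by rintro _ ⟨x, rfl⟩; exact hroot x)
  have hcoeff := congrArg (fun p : Polynomial ℂ => p.coeff i) hP
  simp only [hP_def, Polynomial.finsetSum_coeff, Polynomial.coeff_C_mul_X_pow,
    Polynomial.coeff_zero, Finset.sum_ite_eq, if_pos hi] at hcoeff
  exact hcoeff

/-- **A discontinuous linear functional**: there is a linear functional `φ` on `C([0,1], ℂ)` with
`φ(v_k) = k + 1` for all `k ∈ ℕ` (extend from the linearly independent family `v`,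
`LinearMap.exists_extend`). [folklore] -/
theorem exists_functional : ∃ φ : B →ₗ[ℂ] ℂ, ∀ k : ℕ, φ (v β k) = k + 1 := by
  have hv := linearIndependent_v β
  obtain ⟨φ, hφ⟩ := LinearMap.exists_extend
    ((Finsupp.linearCombination ℂ (fun k : ℕ => ((k : ℂ) + 1))) ∘ₗ hv.repr)
  refine ⟨φ, fun k => ?_⟩
  have hk : v β k ∈ Submodule.span ℂ (Set.range (v β)) :=
    Submodule.subset_span (Set.mem_range_self k)
  have h := LinearMap.congr_fun hφ ⟨v β k, hk⟩
  simp only [LinearMap.coe_comp, Function.comp_apply, Submodule.subtype_apply] at h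
  rw [h, hv.repr_eq_single k ⟨v β k, hk⟩ rfl, Finsupp.linearCombination_single]
  simp

/-! ### `ω_φ` is not a KMS state in the strip form -/

/-- The test element `a = (1 + e^{-βx}) E₂₁`. [folklore] -/
def a₀ : K := ofMat !![0, 0; 1 + expB (-(β : ℂ)), 0]

/-- The test element `b = E₁₂`. [folklore] -/
def b₀ : K := ofMat !![0, 1; 0, 0]

/-- `L(τ_k(b) a) = v_k` for `k ∈ ℕ`. [folklore] -/
theorem L_τ_b₀_mul_a₀ (k : ℕ) : L β (τ k b₀ * a₀ β) = v β k := by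
  ext x
  rw [L_apply_apply, Fin.sum_univ_two, v_apply]
  simp only [toMat_mul, Matrix.mul_apply, Fin.sum_univ_two,
    ContinuousMap.mul_apply, τ_apply_apply, ρ_apply, a₀, b₀, toMat_ofMat, Matrix.of_apply,
    Matrix.cons_val', Matrix.cons_val_zero, Matrix.cons_val_one, Matrix.empty_val',
    Matrix.cons_val_fin_one, ContinuousMap.zero_apply, ContinuousMap.one_apply,
    ContinuousMap.add_apply, expB_apply, η_zero, η_one, ofReal_natCast, ofReal_zero, ofReal_one]
  simp only [mul_zero, add_zero, zero_add, mul_one, sub_zero, zero_sub, zero_mul,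
    exp_zero, one_mul]
  ring_nf

variable {β}

/-- **`ω_φ` is not a `(τ, β)`-KMS state in the strip form** when `φ(v_k) = k + 1`: the strip
function for the pair `(a, b) = ((1 + e^{-βx}) E₂₁, E₁₂)` would be bounded on the strip, but its
upper boundary values are `F(k + iβ) = ω_φ(τ_k(b) a) = φ(v_k) = k + 1`. [folklore] -/
theorem not_isKMSState_omega (hβ : 0 ≤ β) (φ : B →ₗ[ℂ] ℂ) (hφ0 : φ (v β 0) = 1)
    (hφ : ∀ k : ℕ, φ (v β k) = k + 1) : ¬ (omega β φ hφ0).IsKMSState τ β := by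
  intro h
  obtain ⟨F, -, -, ⟨C, hC⟩, -, hFβ⟩ := h (a₀ β) b₀
  obtain ⟨n, hn⟩ := exists_nat_gt C
  have h1 := hFβ n
  rw [omega_apply, L_τ_b₀_mul_a₀, hφ] at h1
  have h2 := hC ((n : ℝ) + β * I) (ofReal_add_mul_I_mem_kmsStrip hβ n)
  rw [h1] at h2
  have h3 : ‖(n : ℂ) + 1‖ = n + 1 := by
    rw [show (n : ℂ) + 1 = ((n + 1 : ℕ) : ℂ) by push_cast; rfl, Complex.norm_natCast]
    push_cast
    rfl
  linarith

/-- **The named fact `State.isKMSState_iff_entire` fails for `K`, `τ` and every `β > 0`**: with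
`φ` as in `exists_functional`, `ω_φ` is a `State K` (discrete order) satisfying the entire-element
relation (`omega_apply_mul_entire`) but not the strip form (`not_isKMSState_omega`). [folklore] -/
theorem not_isKMSState_iff_entire (hβ : 0 < β) :
    ¬ Literature.MathematicalPhysics.QuantumLattice.State.isKMSState_iff_entire (A := K) (τ := τ) (β := β) := by
  intro h
  obtain ⟨φ, hφ⟩ := exists_functional β
  have hφ0 : φ (v β 0) = 1 := by simpa using hφ 0
  exact not_isKMSState_omega hβ.le φ hφ0 hφ
    ((h isAutomorphismGroup_τ hβ (omega β φ hφ0)).mpr (omega_apply_mul_entire β φ hφ0))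

end KMSEntireCounterexample

/-- **`State.isKMSState_iff_entire` is mis-stated**: its universal closure (over all C⋆-algebras
`A`, all partial orders on `A`, all dynamics `τ` and all `β`), i.e. the statement a discharge
`theorem isKMSState_iff_entire_holds : isKMSState_iff_entire` would prove, is false — witnessed by
`A = M₂(C([0,1], ℂ))` with the discrete order, `τ_t = Ad diag(1, e^{itx})`, `β = 1`
(`KMSEntireCounterexample.not_isKMSState_iff_entire`). The equivalence does hold for states of the
C⋆-algebra, i.e. under the additional instance hypothesis `[StarOrderedRing A]`: this is the
corrected named fact `State.isKMSState_iff_entire'`, proved as `State.isKMSState_iff_entire'_holds`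
(from `State.isKMSState_iff_forall_entire`, sibling file `KMSStatesProofs.lean`); the hypothesis
therefore cannot be dropped. [folklore] -/
theorem _root_.Literature.MathematicalPhysics.QuantumLattice.State.not_isKMSState_iff_entire :
    ¬ ∀ (A : Type) [CStarAlgebra A] [PartialOrder A] (τ : ℝ → (A ≃⋆ₐ[ℂ] A)) (β : ℝ),
        Literature.MathematicalPhysics.QuantumLattice.State.isKMSState_iff_entire (A := A) (τ := τ) (β := β) :=
  fun h => KMSEntireCounterexample.not_isKMSState_iff_entire one_pos (h KMSEntireCounterexample.K
    KMSEntireCounterexample.τ 1)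

end Literature.Analysis.FunctionSpaces
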